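import Literature.Computability.AlgebraicComplexity.KV20LinearCircuitEquations
import Literature.Computability.AlgebraicComplexity.ValiantBooleanBridge
import Literature.Computability.Complexity.Space
import HarnessLib

/-!
# Kumar–Volk, Corollary 1.3: any derandomisation of PIT yields new lower bounds (typed statement,
# §1.3 / §6)

Third section file of M. Kumar, B. L. Volk, *A polynomial degree bound on equations for non-rigid
matrices and small linear circuits*, ACM TOCT 14(2) (2022) art. 6 = arXiv:2003.12938 (bib key
`KumarVolk2022`; JOURNAL numbering; locators `[s2 pNNNN]` = chunks of
`lit read paper:doi-10-1145-3543685`, `[tex pNNNN]` = `lit read paper:arxiv-2003.12938`). Sibling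
files: `KV20NonRigidEquations.lean` (§1.1–§1.2, §2–§3), `KV20LinearCircuitEquations.lean` (§1.3,
§4, §5; the linear-circuit model `HasLinCircuit`). This file types Cor 1.3 (= arXiv Cor 3) over
the tree's Boolean-complexity vocabulary (`PITLanguage`, `Classes.P`, `PSPACE`, `FPRel`,
`Nondeterministic.NP`, `constantFreeComplexity`, `IsPBounded`). Honest framing (val-lit): one
cite-tagged `def … : Prop` named fact (D-0014) plus the definitions needed to state it; a
conditional ("win–win") theorem of the source; nothing here bears on `VP ≠ VNP`.

NOT typed: §6's internal machinery (Def 6.1 constant-producing gates / almost-MD circuits, Lemmas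
6.2–6.3) and Cor 6.4 (the tensor-rank analogue: the held journal chunk [s2 p0018] breaks off after
its item (1), so item (2) cannot be quoted; to be typed from the journal PDF if wanted).

Conventions made explicit (read by referees).
* "`PIT ∈ P`": `PIT` = "the set of strings that describe arithmetic circuits (say, over `ℂ`) that
  compute the zero polynomial" ([s2 p0005]); typed as the tree's `PITLanguage ∈ Classes.P`
  (division-free arithmetic circuits over `ℤ`, Kabanets–Impagliazzo's ACIT — the bit-described
  circuits of the source; §6 works with constant-free circuits throughout).
* Item (1), "a family of `n`-variate polynomials of degree `poly(n)` over `ℂ`, which can be computed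
  (as its list of coefficients, given the input `1^n`) in `PSPACE`, which does not have polynomial
  size constant free arithmetic circuits": constant-free circuits compute INTEGER polynomials, so
  the family is `Q : ∀ n, MvPolynomial (Fin n) ℤ` (as in the tree's `kabanets_impagliazzo`);
  "computed as its list of coefficients in `PSPACE`" (a polynomial-space transducer with write-only
  output; the list is exponentially long) is rendered by the standard equivalent BIT-LANGUAGE form:
  the language of queries `(n, e, j, s)` — "is bit `j` of `|coeff_e(Q_n)|` set" (`s = 0`) / "is
  `coeff_e(Q_n)` negative" (`s = 1`) — lies in `PSPACE` (`coeffBitLanguage`); "does not have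
  polynomial size constant free circuits" = `¬ IsPBounded (constantFreeComplexity ∘ Q)`.
* Item (2), "a family of matrices, constructible in polynomial time with an `NP` oracle (given the
  input `1^n`), which requires linear circuits of size `Ω(n²)`": an `FP^{L}` function for some
  `L ∈ NP` (tree `FPRel (Oracle.ofLanguage L)`) mapping `1^n` (`unaryEncodeNat n`) to the encoding
  of an integer `n × n` matrix `M_n` (the matrices of the proof have entries in `{0, …, s}`,
  Lemma 6.3), and `∃ δ > 0`, for all large `n`, every linear circuit (§1.3 model, over `ℂ`)
  computing `M_n` has `≥ δ n²` edges.
-/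

noncomputable section

namespace Literature.Computability.AlgebraicComplexity

open Literature.Computability.Complexity MvPolynomial _root_.Computability

/-! ### The uniformity notions of Cor 1.3 -/

section Uniformity

/-- Boolean encoding of a coefficient query `(n, e, j, s)`: `e` the exponent vector (length `n`),
`j` a bit position, `s ∈ {0, 1}` the query kind. [cite: KumarVolk2022, Cor. 1.3 (item 1)] -/
def coeffQueryEncoding : Encoding (ℕ × List ℕ × ℕ × ℕ) Bool :=
  encodingNatBool.pairBool
    (encodingNatBool.listBool.pairBool (encodingNatBool.pairBool encodingNatBool))

/-- The coefficient of the monomial with exponent list `e` (padded/truncated to length `n`) in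
`Q_n`. [cite: KumarVolk2022, Cor. 1.3 (item 1)] -/
def coeffOfList (Q : ∀ n, MvPolynomial (Fin n) ℤ) (n : ℕ) (e : List ℕ) : ℤ :=
  coeff (Finsupp.equivFunOnFinite.symm fun i : Fin n => e.getD i.1 0) (Q n)

/-- The BIT LANGUAGE of the coefficient lists of the family `Q = (Q_n)`: the queries `(n, e, j, 0)`
with bit `j` of `|coeff_e(Q_n)|` set and the queries `(n, e, j, 1)` with `coeff_e(Q_n) < 0`
(module docstring: "computed as its list of coefficients … in `PSPACE`" ⟺ this language is in
`PSPACE`). [cite: KumarVolk2022, Cor. 1.3 (item 1)] -/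
def coeffBitLanguage (Q : ∀ n, MvPolynomial (Fin n) ℤ) : Language Bool :=
  coeffQueryEncoding.toLanguage {x | x.2.1.length = x.1 ∧
    ((x.2.2.2 = 0 ∧ (coeffOfList Q x.1 x.2.1).natAbs.testBit x.2.2.1 = true) ∨
      (x.2.2.2 = 1 ∧ coeffOfList Q x.1 x.2.1 < 0))}

/-- The integer `n × n` matrix encoded row-major by `l`, read in `ℂ`. [cite: KumarVolk2022, Cor. 1.3 (item 2)] -/
def intMatrixOfList (n : ℕ) (l : List ℤ) : Matrix (Fin n) (Fin n) ℂ :=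
  fun i j => ((l.getD (i.1 * n + j.1) 0 : ℤ) : ℂ)

end Uniformity

/-! ### Corollary 1.3 -/

/-- **Kumar–Volk, Cor 1.3** ([s2 p0005:L9–13]; arXiv Cor 3, [tex p0003]): "Suppose `PIT ∈ P`. Then at
least one of the following is true: (1) There exists a family of `n`-variate polynomials of degree
`poly(n)` over `ℂ`, which can be computed (as its list of coefficients, given the input `1^n`) in
`PSPACE`, which does not have polynomial size constant free arithmetic circuits. (2) there exists a
family of matrices, constructible in polynomial time with an `NP` oracle (given the input `1^n`),
which requires linear circuits of size `Ω(n²)`." (Proved in §6 from Thm 1.2 via almost-MD circuits,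
Malod–Portier, and the search-to-decision Lemma 6.3; "the result holds under any derandomization of
PIT … even under white box derandomization".) The two disjuncts are rendered as in the module
docstring (item (1): integer family `Q`, p-bounded degree, coefficient bit-language in `PSPACE`,
not p-bounded constant-free complexity; item (2): an `FP^L` function, `L ∈ NP`, printing on `1^n` an
integer matrix all of whose linear circuits over `ℂ` have `≥ δn²` edges, for large `n`).
[cite: KumarVolk2022, Cor. 1.3] -/
def kumarVolk2020_cor_1_3 : Prop :=
  PITLanguage ∈ Classes.P →
    (∃ Q : ∀ n, MvPolynomial (Fin n) ℤ,
      IsPBounded (fun n => (Q n).totalDegree) ∧ coeffBitLanguage Q ∈ PSPACE ∧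
        ¬ IsPBounded (fun n => constantFreeComplexity (Q n))) ∨
    (∃ L : Language Bool, L ∈ Nondeterministic.NP ∧
      ∃ f : List Bool → List Bool, f ∈ FPRel (Oracle.ofLanguage L) ∧
        ∃ δ : ℝ, 0 < δ ∧ ∃ n₀ : ℕ, ∀ n : ℕ, n₀ ≤ n →
          ∃ l : List ℤ, encodingIntBool.listBool.decode (f (unaryEncodeNat n)) = some l ∧
            l.length = n ^ 2 ∧
            ∀ s : ℕ, HasLinCircuit ℂ s (intMatrixOfList n l) → δ * (n : ℝ) ^ 2 ≤ s)

end Literature.Computability.AlgebraicComplexity
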